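/-
Copyright (c) 2026. All rights reserved.
Released under Apache 2.0 license as described in the file LICENSE.
Authors: abc-iut cell, wave-4 seat abc-iut-w4-d059 (proof-only; (AI3) for the produced data with ONLY
dictionary-shaped inputs: reference pro-branches and transitivity discharged).
-/
import Literature.AnabelianGeometry.SemiGraphs.ArithReferencePairCpt
import Literature.AnabelianGeometry.SemiGraphs.ArithEdgeStabilizerOfEdgeData
import HarnessLib

/-!
# (compact-`C` twin, α12-1)  [SemiAnbd] Thm 5.4 (i) p. 66 / §5 p. 65: the (AI3) fields `edge` / `edgeFix` for the PRODUCED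
# decomposition data from the geometric dictionaries alone (proof-only)

Mochizuki, *Semi-graphs of anabelioids*, Publ. RIMS **42** (2006), §5 p. 65 ("`Π^temp_{𝔊,b}` … the
commensurator in `Π^temp_{𝔊,v}` of `Π^temp_{𝔾,b}`") and the proof of Thm 5.4 (i) p. 66 ("entirely similar
to … Theorem 3.7 (iii)", p. 41, with the author's Comments (6)). [cite: MochizukiSemiAnbd2006, Thm 5.4 (i), p. 66]

PROOF-ONLY sequel to this seat's `ArithEdgeStabilizer.lean` (gen 0: `edgeFix_decompositionDataOfChart`,
`edge_decompositionDataOfChart_of_ends`) and `ArithEdgeStabilizerInputs.lean` (gen 2: the pair inputs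
discharged).  The remaining producer-side binders of the gen-0 theorems are DISCHARGED here:

* the reference pro-branches `hX` / `hY` of the chosen representatives `R.Hv v` ⊇ `R.Hb b`: from the
  two-sided vertex dictionary `hfixN` (`R.Hv v` is the stabiliser of some `X`), the edge converse
  `hedgeFixN` (`R.Hb b` is the stabiliser of an end pair `(x, y)`) and `not_three_fixed_of_ne_bot`
  (`R.Hb b ≠ 1` fixes `X`, `x`, `y`, so `X ∈ {x, y}`) — `exists_referencePair`;
* the transitivity `hEtrans` of `Π^temp_𝔾` on the pro-branches above a branch of `𝔾`: FREE from "the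
  edge-like subgroups of one edge form one conjugacy class" (`exists_conj_of_mem_edgeLikeSubgroups`,
  Prop 3.2) and "a nontrivial stabiliser determines its end pair" (`ends_eq_or_swap_of_stabilizer_iff`);
* the end-point data of an ARBITRARY eventual compatible system of tree edges (trees whose edges are
  closed, i.e. universal graph-coverings of GRAPHS): `exists_ends_of_compatible_edges` of the generic
  companion `TreeSystemEdgeEnds.lean`.

Result: `edgeFix_decompositionDataOfChart_of_edgeData` and `edge_decompositionDataOfChart_of_edgeData` —
the LITERAL field texts (AI3) of abc-iut-w4-d053's `ArithLevelData` for `D := decompositionDataOfChart R ι`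
— whose binders are only: `ι` injective with normal image, trees over graphs with functorial equivariant
transitions, the finite levels (`quot`, `levelAct`, `levelTrans` fields), the estrangement consequence
`hnobpN`, and the TWO-SIDED geometric dictionaries (I1) `hfixN`, (I2) `hstabN`, (I3) `hedgeN` with its
converse `hedgeFixN` for the restricted action of `Π^temp_𝔾` — the producer contract of row T54-B.
No `CompactInVerticial`; no definition; nothing here takes a side on [IUTchIII] Cor. 3.12.

COMPACT-`C` TWIN (α12-1 disposition of FINDING F-d029g3-1, abc-iut-w4-d029 g3, 2026-08-26): the
estrangement input is taken in the dischargeable form `hnobpNCpt : ∀ C, IsCompact C → (C fixes a compatible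
finite-level branch-pair system) → C = ⊥` — the all-subgroups form `hnobpN` of the untwinned file is FALSE over
towers whose finite levels do not separate points (the joint kernel fixes every system).  Every application
is at a COMPACT subgroup (edge-like subgroups and their pairwise meets, `isCompact_of_mem_edgeLikeSubgroups`),
so the proofs are those of the untwinned file verbatim with `IsCompact` threaded; `_cpt` names throughout.
-/

namespace Literature.AnabelianGeometry.SemiGraphs

open CategoryTheory
open scoped Pointwise

universe v u u'

namespace ProfiniteSemiGraph

variable {𝒢 : ProfiniteSemiGraph.{u}} {c : TemperedPiChart 𝒢} {Gtp : Type u'} [Group Gtp]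
  (ι : c.G →* Gtp) {J : Type v} [Preorder J] [IsDirectedOrder J]
  (T : J → SemiGraph.{u}) (ρ : ∀ j, Gtp →* Aut (T j)) (f : ∀ ⦃i j : J⦄, i ≤ j → (T j ⟶ T i))
  (level : J → SemiGraph.{u}) [∀ j, Finite (level j).Vertex] [∀ j, Finite (level j).Branch]
  (levelAct : ∀ j, Gtp →* Aut (level j)) (quot : ∀ j, T j ⟶ level j)
  (levelTrans : ∀ ⦃i j : J⦄, i ≤ j → (level j ⟶ level i))

/-! ### The fields (AI3) `edgeFix` / `edge` for the produced data, dictionary inputs only -/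

/-- **Field (AI3) `edgeFix` of `ArithLevelData` for the PRODUCED data `decompositionDataOfChart R ι`, from the
geometric dictionaries alone** (Thm 5.4 (i) p. 66 via Thm 3.7 (iii) p. 41): every edge-like subgroup — a
conjugate `g₀ · Π^temp_{𝔊,b} · g₀⁻¹` — IS the full stabiliser of an eventual compatible system of tree
edges with their branches, given with its two end-vertex systems (the translate by `g₀` of the reference
pro-branch of `b`).  The statement is the field text verbatim; compare gen 0's
`edgeFix_decompositionDataOfChart` (abstract adjacency, reference pro-branches and pair inputs as binders).
[cite: MochizukiSemiAnbd2006, Thm 5.4 (i), p. 66] -/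
theorem edgeFix_decompositionDataOfChart_of_edgeData_cpt (h𝒢 : 𝒢.Thm37Hypotheses) (R : ChartRepresentatives c)
    (hι : Function.Injective ι) (hnorm : (ι.range).Normal) (hT : ∀ j, (T j).IsTree)
    (f_id : ∀ j, f (le_refl j) = 𝟙 (T j))
    (f_comp : ∀ ⦃i j k : J⦄ (hij : i ≤ j) (hjk : j ≤ k), f hjk ≫ f hij = f (hij.trans hjk))
    (trans_act : ∀ ⦃i j : J⦄ (h : i ≤ j) (g : Gtp), (ρ j g).hom ≫ f h = f h ≫ (ρ i g).hom)
    (quot_isImmersion : ∀ j, SemiGraph.IsImmersion (quot j))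
    (act_quot : ∀ (j : J) (g : Gtp), (ρ j g).hom ≫ quot j = quot j ≫ (levelAct j g).hom)
    (levelTrans_id : ∀ j, levelTrans (le_refl j) = 𝟙 (level j))
    (levelTrans_comp : ∀ ⦃i j k : J⦄ (hij : i ≤ j) (hjk : j ≤ k),
      levelTrans hjk ≫ levelTrans hij = levelTrans (hij.trans hjk))
    (levelTrans_act : ∀ ⦃i j : J⦄ (h : i ≤ j) (g : Gtp),
      (levelAct j g).hom ≫ levelTrans h = levelTrans h ≫ (levelAct i g).hom)
    (trans_quot : ∀ ⦃i j : J⦄ (h : i ≤ j), f h ≫ quot i = quot j ≫ levelTrans h)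
    (hnobpNCpt : ∀ (C : Subgroup c.G), IsCompact (C : Set c.G) →
      ∀ (j₀ : J) (w : ∀ i : {i : J // j₀ ≤ i}, (level i.1).Vertex)
      (β β' : ∀ i : {i : J // j₀ ≤ i}, (level i.1).Branch),
      (∀ i, β i ≠ β' i ∧ (level i.1).abuts (β i) = some (w i) ∧ (level i.1).abuts (β' i) = some (w i)) →
      (∀ ⦃i i' : {i : J // j₀ ≤ i}⦄ (h : i.1 ≤ i'.1), (levelTrans h).vertexMap (w i') = w i ∧
        (levelTrans h).branchMap (β i') = β i ∧ (levelTrans h).branchMap (β' i') = β' i) →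
      (∀ (i : {i : J // j₀ ≤ i}) (γ : C), (levelAct i.1 (ι γ)).hom.vertexMap (w i) = w i ∧
        (levelAct i.1 (ι γ)).hom.branchMap (β i) = β i ∧
          (levelAct i.1 (ι γ)).hom.branchMap (β' i) = β' i) → C = ⊥)
    (hfixN : ∀ (v : 𝒢.graph.Vertex) (H : Subgroup c.G), H ∈ verticialSubgroups c v →
      ∃ x : ∀ j, (T j).Vertex, (∀ ⦃i j : J⦄ (h : i ≤ j), (f h).vertexMap (x j) = x i) ∧
        ∀ n : c.G, n ∈ H ↔ ∀ j, (ρ j (ι n)).hom.vertexMap (x j) = x j)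
    (hstabN : ∀ x : ∀ j, (T j).Vertex, (∀ ⦃i j : J⦄ (h : i ≤ j), (f h).vertexMap (x j) = x i) →
      ∃ (v : 𝒢.graph.Vertex) (H : Subgroup c.G), H ∈ verticialSubgroups c v ∧
        ∀ n : c.G, n ∈ H ↔ ∀ j, (ρ j (ι n)).hom.vertexMap (x j) = x j)
    (hedgeN : ∀ (j₁ : J) (ε : ∀ j : {j : J // j₁ ≤ j}, (T j.1).Edge),
      (∀ ⦃i j : {j : J // j₁ ≤ j}⦄ (h : i.1 ≤ j.1), (f h).edgeMap (ε j) = ε i) →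
      ∃ (e : 𝒢.graph.Edge) (L : Subgroup c.G), L ∈ edgeLikeSubgroups c e ∧
        ∀ n : c.G, n ∈ L ↔ ∀ j, (ρ j.1 (ι n)).hom.edgeMap (ε j) = ε j ∧
          ∀ b : (T j.1).Branch, (T j.1).edgeOf b = ε j → (ρ j.1 (ι n)).hom.branchMap b = b)
    (hedgeFixN : ∀ (e : 𝒢.graph.Edge) (K : Subgroup c.G), K ∈ edgeLikeSubgroups c e →
      ∃ (j₁ : J) (ε : ∀ j : {j : J // j₁ ≤ j}, (T j.1).Edge) (c₁ c₂ : ∀ j : {j : J // j₁ ≤ j}, (T j.1).Branch)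
        (x₁ x₂ : ∀ j, (T j).Vertex),
        (∀ ⦃i j : J⦄ (h : i ≤ j), (f h).vertexMap (x₁ j) = x₁ i) ∧
        (∀ ⦃i j : J⦄ (h : i ≤ j), (f h).vertexMap (x₂ j) = x₂ i) ∧
        (∀ j, x₁ j.1 ≠ x₂ j.1 ∧ (T j.1).edgeOf (c₁ j) = ε j ∧ (T j.1).edgeOf (c₂ j) = ε j ∧
          (T j.1).abuts (c₁ j) = some (x₁ j.1) ∧ (T j.1).abuts (c₂ j) = some (x₂ j.1)) ∧
        ∀ n : c.G, n ∈ K ↔ ∀ j, (ρ j.1 (ι n)).hom.edgeMap (ε j) = ε j ∧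
          ∀ b : (T j.1).Branch, (T j.1).edgeOf b = ε j → (ρ j.1 (ι n)).hom.branchMap b = b)
    (hG : 𝒢.graph.IsGraph) (L : Subgroup Gtp) (hL : IsEdgeLike (decompositionDataOfChart R ι) L) :
    ∃ (i : J) (ε : ∀ j : {j : J // i ≤ j}, (T j.1).Edge) (c₁ c₂ : ∀ j : {j : J // i ≤ j}, (T j.1).Branch)
      (x₁ x₂ : ∀ j, (T j).Vertex),
      (∀ ⦃i' j : J⦄ (h : i' ≤ j), (f h).vertexMap (x₁ j) = x₁ i') ∧
      (∀ ⦃i' j : J⦄ (h : i' ≤ j), (f h).vertexMap (x₂ j) = x₂ i') ∧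
      (∀ j, x₁ j.1 ≠ x₂ j.1 ∧ (T j.1).edgeOf (c₁ j) = ε j ∧ (T j.1).edgeOf (c₂ j) = ε j ∧
        (T j.1).abuts (c₁ j) = some (x₁ j.1) ∧ (T j.1).abuts (c₂ j) = some (x₂ j.1)) ∧
      ∀ g : Gtp, g ∈ L ↔ ∀ j, (ρ j.1 g).hom.edgeMap (ε j) = ε j ∧
        ∀ b : (T j.1).Branch, (T j.1).edgeOf b = ε j → (ρ j.1 g).hom.branchMap b = b := by
  have hequiv := trans_act_vertexMap' T ρ f trans_act
  obtain ⟨b, g₀, rfl⟩ := hL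
  obtain ⟨v, hb⟩ := Option.isSome_iff_exists.mp (hG.abuts_isSome b)
  obtain ⟨x, y, hx, hy, hxy, -, hS⟩ := exists_pair_mem_arithBrGp_iff_cpt ι T ρ f level levelAct quot levelTrans h𝒢 R hι hnorm hT
    f_id f_comp trans_act quot_isImmersion act_quot levelTrans_id levelTrans_comp levelTrans_act trans_quot hnobpNCpt
    hfixN hstabN hedgeN hedgeFixN hb
  -- the translated pair and its end-point data
  obtain ⟨i, ε, cc, cc', hends⟩ := exists_ends_translate T ρ hxy g₀
  refine ⟨i, ε, cc, cc', fun j => (ρ j g₀).hom.vertexMap (x j), fun j => (ρ j g₀).hom.vertexMap (y j),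
    compatible_translate T ρ f hequiv hx g₀, compatible_translate T ρ f hequiv hy g₀, hends, fun g => ?_⟩
  rw [decompositionDataOfChart_brGp, mem_conjSubgroup_pairStabilizer_iff T ρ hS g₀ g]
  exact (edgeSystem_fixed_iff_ends_fixed T ρ f hT hequiv (compatible_translate T ρ f hequiv hx g₀)
    (compatible_translate T ρ f hequiv hy g₀) hends g).symm

/-- **Field (AI3) `edge` of `ArithLevelData` for the PRODUCED data `decompositionDataOfChart R ι`, from the
geometric dictionaries alone** (Thm 5.4 (i) p. 66 via Thm 3.7 (iii) p. 41): the full stabiliser in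
`Π^temp_𝔊` of ANY eventual compatible system of tree edges with their branches IS an edge-like subgroup.
The trees are graphs (all edges closed: `hTg`), so the system has end systems `(x₁, x₂)`
(`exists_ends_of_compatible_edges`); its `Π^temp_𝔾`-stabiliser is edge-like at some edge `e` (`hedgeN`),
hence (one conjugacy class per edge, Prop 3.2) a conjugate `n₀ · Π^temp_{𝔾,b} · n₀⁻¹` for a branch `b` of
`e`; a nontrivial stabiliser determines its end pair, so `(x₁, x₂) = n₀ · (x, y)` up to order for the
reference pro-branch `(x, y)` of `b`, and the stabiliser is `ι(n₀) · Π^temp_{𝔊,b} · ι(n₀)⁻¹`.  The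
statement is the field text verbatim; compare gen 0's `edge_decompositionDataOfChart_of_ends` (end data,
transitivity `hEtrans` and pair inputs as binders). [cite: MochizukiSemiAnbd2006, Thm 5.4 (i), p. 66] -/
theorem edge_decompositionDataOfChart_of_edgeData_cpt (h𝒢 : 𝒢.Thm37Hypotheses) (R : ChartRepresentatives c)
    (hι : Function.Injective ι) (hnorm : (ι.range).Normal) (hT : ∀ j, (T j).IsTree)
    (f_id : ∀ j, f (le_refl j) = 𝟙 (T j))
    (f_comp : ∀ ⦃i j k : J⦄ (hij : i ≤ j) (hjk : j ≤ k), f hjk ≫ f hij = f (hij.trans hjk))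
    (trans_act : ∀ ⦃i j : J⦄ (h : i ≤ j) (g : Gtp), (ρ j g).hom ≫ f h = f h ≫ (ρ i g).hom)
    (quot_isImmersion : ∀ j, SemiGraph.IsImmersion (quot j))
    (act_quot : ∀ (j : J) (g : Gtp), (ρ j g).hom ≫ quot j = quot j ≫ (levelAct j g).hom)
    (levelTrans_id : ∀ j, levelTrans (le_refl j) = 𝟙 (level j))
    (levelTrans_comp : ∀ ⦃i j k : J⦄ (hij : i ≤ j) (hjk : j ≤ k),
      levelTrans hjk ≫ levelTrans hij = levelTrans (hij.trans hjk))
    (levelTrans_act : ∀ ⦃i j : J⦄ (h : i ≤ j) (g : Gtp),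
      (levelAct j g).hom ≫ levelTrans h = levelTrans h ≫ (levelAct i g).hom)
    (trans_quot : ∀ ⦃i j : J⦄ (h : i ≤ j), f h ≫ quot i = quot j ≫ levelTrans h)
    (hnobpNCpt : ∀ (C : Subgroup c.G), IsCompact (C : Set c.G) →
      ∀ (j₀ : J) (w : ∀ i : {i : J // j₀ ≤ i}, (level i.1).Vertex)
      (β β' : ∀ i : {i : J // j₀ ≤ i}, (level i.1).Branch),
      (∀ i, β i ≠ β' i ∧ (level i.1).abuts (β i) = some (w i) ∧ (level i.1).abuts (β' i) = some (w i)) →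
      (∀ ⦃i i' : {i : J // j₀ ≤ i}⦄ (h : i.1 ≤ i'.1), (levelTrans h).vertexMap (w i') = w i ∧
        (levelTrans h).branchMap (β i') = β i ∧ (levelTrans h).branchMap (β' i') = β' i) →
      (∀ (i : {i : J // j₀ ≤ i}) (γ : C), (levelAct i.1 (ι γ)).hom.vertexMap (w i) = w i ∧
        (levelAct i.1 (ι γ)).hom.branchMap (β i) = β i ∧
          (levelAct i.1 (ι γ)).hom.branchMap (β' i) = β' i) → C = ⊥)
    (hfixN : ∀ (v : 𝒢.graph.Vertex) (H : Subgroup c.G), H ∈ verticialSubgroups c v →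
      ∃ x : ∀ j, (T j).Vertex, (∀ ⦃i j : J⦄ (h : i ≤ j), (f h).vertexMap (x j) = x i) ∧
        ∀ n : c.G, n ∈ H ↔ ∀ j, (ρ j (ι n)).hom.vertexMap (x j) = x j)
    (hstabN : ∀ x : ∀ j, (T j).Vertex, (∀ ⦃i j : J⦄ (h : i ≤ j), (f h).vertexMap (x j) = x i) →
      ∃ (v : 𝒢.graph.Vertex) (H : Subgroup c.G), H ∈ verticialSubgroups c v ∧
        ∀ n : c.G, n ∈ H ↔ ∀ j, (ρ j (ι n)).hom.vertexMap (x j) = x j)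
    (hedgeN : ∀ (j₁ : J) (ε : ∀ j : {j : J // j₁ ≤ j}, (T j.1).Edge),
      (∀ ⦃i j : {j : J // j₁ ≤ j}⦄ (h : i.1 ≤ j.1), (f h).edgeMap (ε j) = ε i) →
      ∃ (e : 𝒢.graph.Edge) (L : Subgroup c.G), L ∈ edgeLikeSubgroups c e ∧
        ∀ n : c.G, n ∈ L ↔ ∀ j, (ρ j.1 (ι n)).hom.edgeMap (ε j) = ε j ∧
          ∀ b : (T j.1).Branch, (T j.1).edgeOf b = ε j → (ρ j.1 (ι n)).hom.branchMap b = b)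
    (hedgeFixN : ∀ (e : 𝒢.graph.Edge) (K : Subgroup c.G), K ∈ edgeLikeSubgroups c e →
      ∃ (j₁ : J) (ε : ∀ j : {j : J // j₁ ≤ j}, (T j.1).Edge) (c₁ c₂ : ∀ j : {j : J // j₁ ≤ j}, (T j.1).Branch)
        (x₁ x₂ : ∀ j, (T j).Vertex),
        (∀ ⦃i j : J⦄ (h : i ≤ j), (f h).vertexMap (x₁ j) = x₁ i) ∧
        (∀ ⦃i j : J⦄ (h : i ≤ j), (f h).vertexMap (x₂ j) = x₂ i) ∧
        (∀ j, x₁ j.1 ≠ x₂ j.1 ∧ (T j.1).edgeOf (c₁ j) = ε j ∧ (T j.1).edgeOf (c₂ j) = ε j ∧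
          (T j.1).abuts (c₁ j) = some (x₁ j.1) ∧ (T j.1).abuts (c₂ j) = some (x₂ j.1)) ∧
        ∀ n : c.G, n ∈ K ↔ ∀ j, (ρ j.1 (ι n)).hom.edgeMap (ε j) = ε j ∧
          ∀ b : (T j.1).Branch, (T j.1).edgeOf b = ε j → (ρ j.1 (ι n)).hom.branchMap b = b)
    (hG : 𝒢.graph.IsGraph) (hTg : ∀ j, (T j).IsGraph)
    (j₁ : J) (ε : ∀ j : {j : J // j₁ ≤ j}, (T j.1).Edge)
    (hε : ∀ ⦃i j : {j : J // j₁ ≤ j}⦄ (h : i.1 ≤ j.1), (f h).edgeMap (ε j) = ε i) :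
    ∃ L : Subgroup Gtp, IsEdgeLike (decompositionDataOfChart R ι) L ∧
      ∀ g : Gtp, g ∈ L ↔ ∀ j, (ρ j.1 g).hom.edgeMap (ε j) = ε j ∧
        ∀ b : (T j.1).Branch, (T j.1).edgeOf b = ε j → (ρ j.1 g).hom.branchMap b = b := by
  have hequiv := trans_act_vertexMap' T ρ f trans_act
  have hequivN : ∀ ⦃i j : J⦄ (h : i ≤ j) (n : c.G) (z : (T j).Vertex),
      (f h).vertexMap (((ρ j).comp ι n).hom.vertexMap z) = ((ρ i).comp ι n).hom.vertexMap ((f h).vertexMap z) :=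
    fun i j h n z => hequiv h (ι n) z
  -- end systems of `ε` and their `Π^temp_𝔾`-stabiliser, edge-like at some edge `e`
  obtain ⟨c₁, c₂, x₁, x₂, hx₁, hx₂, hends⟩ := exists_ends_of_compatible_edges T f hT hTg f_comp ε hε
  obtain ⟨e, K, hK, hKiff⟩ :=
    hEstabN_of_edgeData ι T ρ f hT trans_act hedgeN x₁ x₂ hx₁ hx₂ ⟨j₁, ε, c₁, c₂, hends⟩
  have hKbot : K ≠ ⊥ := ne_bot_of_mem_edgeLikeSubgroups verticialInjective_holds h𝒢 c hK
  -- a branch `b` of `e`, abutting to `v`; the reference pro-branch `(x, y)` of `b`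
  obtain ⟨b, -, -, hbe, -, -⟩ := 𝒢.graph.two_branches e
  obtain ⟨v, hb⟩ := Option.isSome_iff_exists.mp (hG.abuts_isSome b)
  obtain ⟨x, y, hx, hy, hxy, hbN, hS⟩ := exists_pair_mem_arithBrGp_iff_cpt ι T ρ f level levelAct quot levelTrans h𝒢 R hι hnorm hT
    f_id f_comp trans_act quot_isImmersion act_quot levelTrans_id levelTrans_comp levelTrans_act trans_quot hnobpNCpt
    hfixN hstabN hedgeN hedgeFixN hb
  -- `K` is a `Π^temp_𝔾`-conjugate of `R.Hb b`: the stabiliser of `n₀ · (x, y)`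
  have hbK : R.Hb b ∈ edgeLikeSubgroups c e := hbe ▸ R.Hb_mem b
  obtain ⟨n₀, hKconj⟩ := exists_conj_of_mem_edgeLikeSubgroups c hbK hK
  have hKiff' : ∀ n : c.G, n ∈ K ↔
      (∀ j, (ρ j (ι n)).hom.vertexMap ((ρ j (ι n₀)).hom.vertexMap (x j)) = (ρ j (ι n₀)).hom.vertexMap (x j)) ∧
      ∀ j, (ρ j (ι n)).hom.vertexMap ((ρ j (ι n₀)).hom.vertexMap (y j)) = (ρ j (ι n₀)).hom.vertexMap (y j) := by
    intro n
    rw [hKconj]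
    exact mem_conjSubgroup_pairStabilizer_iff T (fun j => (ρ j).comp ι) hbN n₀ n
  -- so `(x₁, x₂) = n₀ · (x, y)` up to order
  obtain ⟨i', ε', cc, cc', hends'⟩ := exists_ends_translate T (fun j => (ρ j).comp ι) hxy n₀
  rcases ends_eq_or_swap_of_stabilizer_iff_cpt ι T ρ f level levelAct quot levelTrans hT quot_isImmersion act_quot
      levelTrans_id levelTrans_comp levelTrans_act trans_quot hnobpNCpt hKbot
      (isCompact_of_mem_edgeLikeSubgroups c hK) hx₁ hx₂
      (compatible_translate T (fun j => (ρ j).comp ι) f hequivN hx n₀)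
      (compatible_translate T (fun j => (ρ j).comp ι) f hequivN hy n₀) hKiff hKiff'
      (hends ⟨j₁, le_rfl⟩).1 (hends' ⟨i', le_rfl⟩).1 with ⟨h₁, h₂⟩ | ⟨h₁, h₂⟩
  · refine ⟨conjSubgroup (ι n₀) (arithBrGp R ι b), ⟨b, ι n₀, by rw [decompositionDataOfChart_brGp]⟩, fun g => ?_⟩
    rw [mem_conjSubgroup_pairStabilizer_iff T ρ hS (ι n₀) g, edgeSystem_fixed_iff_ends_fixed T ρ f hT hequiv hx₁ hx₂ hends g,
      ← h₁, ← h₂]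
    rfl
  · refine ⟨conjSubgroup (ι n₀) (arithBrGp R ι b), ⟨b, ι n₀, by rw [decompositionDataOfChart_brGp]⟩, fun g => ?_⟩
    rw [mem_conjSubgroup_pairStabilizer_iff T ρ hS (ι n₀) g, edgeSystem_fixed_iff_ends_fixed T ρ f hT hequiv hx₁ hx₂ hends g,
      ← h₁, ← h₂, and_comm]
    rfl

end ProfiniteSemiGraph

end Literature.AnabelianGeometry.SemiGraphs
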